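import Summits.NavierStokesRegularity.NavierStokesRegularity.Theses.LevelSetModeration
import Summits.NavierStokesRegularity.NavierStokesRegularity.Theorems.TypeICertificateLadderNoBlowupToClay
import Literature.Analysis.FluidPDE.KNSSTypeIIHolds

/-!
# Route LevelSetModeration — `BoundedToClay` (item stmt-NavierStokesRegularity-18539)

BOUNDED ⇒ CLAY (A): if every classical solution of the unforced Navier–Stokes system on
`ℝ³ × [0, T)` which is Leray–Hopf on `[0, T]` from a rapidly decaying datum is bounded on
`[0, T) × ℝ³` (all `ν, T > 0`), then Fefferman's statement (A) holds.

Proof: composition of two theorems already in the tree —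
* `Literature.Analysis.FluidPDE.hasSmoothExtensionPast_of_bounded_holds` (Robinson–Rodrigo–Sadowski
  2016, Thm. 8.17: a classical Leray–Hopf solution bounded on `[0, T) × ℝ³` extends smoothly past `T`),
* `Summit.NavierStokesRegularity.NavierStokesRegularity.Theorems.typeICertificateLadder_noBlowupToClay_proof`
  (item stmt-NavierStokesRegularity-0055, `NoBlowup → NavierStokesRegularity`).

## Cone hygiene (why this file is landed `--supports`, not `--workitem`)

This module imports `Theorems.TypeICertificateLadderNoBlowupToClay` and
`Literature.Analysis.FluidPDE.KNSSTypeIIHolds`, whose import closure (670 project modules) contains 13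
modules declaring 26 undischarged rider facts (several of them open problems, e.g.
`PartialRegularity.TypeISingularityExists`, `MildSolutions.RusinSverakQuestion`). None of them is USED
by the proof (closed statement, axioms `propext, Classical.choice, Quot.sound`), but closing the item
`--by` this theorem appends a `BoundedToClay_holds` link that imports this module into the route file
`Theses/LevelSetModeration.lean`, whose import cone the route's planner deliberately cut to 16
definition modules (rev 1, 2026-08-17). Per the planner and the route-review refuter: close the item
with `ledger workitem release stmt-NavierStokesRegularity-18539 --by
Summit.NavierStokesRegularity.NavierStokesRegularity.Theorems.levelSetModeration_boundedToClay_proof`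
only once the cruxes `HighSpeedPressureWork` / `LevelSetClosure` have closed (the route then closes
outright), or once the rider facts have left that import closure / the import-cone guardrail is retired
in favour of the gate's used-constants `deps_unproved` (which this proof does not touch).

## References
* J. C. Robinson, J. L. Rodrigo, W. Sadowski, *The Three-Dimensional Navier–Stokes Equations*,
  CUP 2016, Thm. 8.17. [RobinsonRodrigoSadowski2016]
* C. L. Fefferman, *Existence and smoothness of the Navier–Stokes equation*, Clay (2000), (A).
  [Fefferman2000]
-/

-- single-conjunct summit: `Summit.<Summit>.<Problem>` repeats the name by the D-0017 layout
set_option linter.dupNamespace false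

namespace Summit.NavierStokesRegularity.NavierStokesRegularity.Theorems

open Literature.Analysis.FluidPDE

/-- **`BoundedToClay`** (item stmt-NavierStokesRegularity-18539 of route LevelSetModeration): if every
classical Leray–Hopf solution of unforced Navier–Stokes on `ℝ³ × [0, T)` from a rapidly decaying datum is
bounded on `[0, T) × ℝ³`, then Clay (A) holds — bounded continuation
(`hasSmoothExtensionPast_of_bounded_holds`, RRS 2016 Thm. 8.17) composed with `NoBlowup → (A)`
(`typeICertificateLadder_noBlowupToClay_proof`). -/
theorem levelSetModeration_boundedToClay_proof :
    Summit.NavierStokesRegularity.NavierStokesRegularity.Theses.LevelSetModeration.BoundedToClay := by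
  intro h
  exact typeICertificateLadder_noBlowupToClay_proof fun ν T hν hT u p hcl hLH hdec =>
    hasSmoothExtensionPast_of_bounded_holds hν hT hcl hLH (h ν T hν hT u p hcl hLH hdec)

end Summit.NavierStokesRegularity.NavierStokesRegularity.Theorems
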